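import Summits.RiemannHypothesis.RiemannHypothesis.Theorems.WeilFormatCWindowSesq
import Summits.RiemannHypothesis.RiemannHypothesis.Theorems.WeilFormatCWindowPolyProfile
import Summits.RiemannHypothesis.RiemannHypothesis.Theorems.WeilFormatCEntryIncrement
import HarnessLib

/-!
# Format C, design C∞ (L2–I): the increment pairing of indicator windows through shifted overlaps;
  monomial windows

Route context: Fourier–Galerkin / Schur-complement certificates of Weil positivity on a window ("format C";
cell memo `run/shared/lean/pub/rh-explicit/rh-explicit-weil-10/FORMATC-DESIGN.md` §9.12.7–§9.12.11, KERNEL-LEVER.md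
§11–§13; supporting stmt-RiemannHypothesis-0098; seat rh-explicit-weil-10).  The deflated certificate of design C∞ augments
the Fourier block of the window `[−a, a]` by window POLYNOMIALS `p·1_{[−a,a]}`; the new Gram entries are the values of
the sesquilinear window form `weilWindowSesq a` (`WeilFormatCDefs.lean`: `P(u,v) + 𝓔_a(u,v) − M_a ∫ u conj v`) on pairs of
polynomial windows and on (polynomial window, `χ_m`) pairs.  By sesquilinearity
(`weilWindowSesq_sum_left/right`) everything reduces to MONOMIAL windows `x^j·1_{[−a,a]}`.  This file is the
increment / prime-block layer of that computation (the analogue of `WeilFormatCEntryIncrement.lean` for the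
trigonometric windows):

* `weilIncrementSesq_eq_overlap` — for window functions `u, v`:
  `D_t(u, v) = 2∫ u conj v − ∫ u(x+t) conj v(x) dx − conj ∫ v(x+t) conj u(x) dx` (any `t`);
* indicator windows `1_{[−a,a]}·f`: the three integrals are window integrals, `∫_{−a}^{a} f conj g` and
  `∫_{−a}^{a−t} f(x+t) conj g(x) dx` (`0 ≤ t ≤ 2a`), the shifted overlap vanishing for `t ≥ 2a`
  (`weilIncrementSesq_indicator`, `weilIncrementSesq_indicator_of_le`);
* monomial windows: `1·x^j` is a window function, `∫_{−a}^{a} x^j x^k = (a^{j+k+1} − (−a)^{j+k+1})/(j+k+1)`,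
  the shifted overlap `∫_{−a}^{a−t} (x+t)^j x^k dx = Σ_{i≤j} C(j,i) t^{j−i}((a−t)^{i+k+1} − (−a)^{i+k+1})/(i+k+1)`,
  hence `D_t(1·x^j, 1·x^k)` as an explicit REAL polynomial in `t` on `0 ≤ t ≤ 2a` and the constant
  `2∫x^{j+k}` beyond (`weilIncrementSesq_indicator_pow`, `…_of_le`), and the prime block
  `Σ_{log n<2a} Λ(n)n^{-1/2} D_{log n}` of two monomial windows as a real number (`sum_prime_weilIncrementSesq_indicator_pow`).

Pole part, archimedean part and the assembled entries follow in sibling files.  Pure calculus; standard axioms; no RH claim.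
-/

set_option autoImplicit false
-- `Summit.RiemannHypothesis.RiemannHypothesis.…` is the layout-mandated namespace (summit = problem name).
set_option linter.dupNamespace false

noncomputable section

open Complex Filter Set MeasureTheory
open scoped Real Topology ComplexConjugate ArithmeticFunction.vonMangoldt

namespace Summit.RiemannHypothesis.RiemannHypothesis.Theorems.WeilFormatC

open Literature.NumberTheory.LFunctions

variable {a : ℝ} {u v : ℝ → ℂ}

/-! ## The increment pairing of window functions through shifted overlaps -/

namespace IsWindowFunction

/-- `u(x + t) · conj v(x)` is integrable for window functions `u, v`. -/
theorem integrable_shift_mul_conj (hu : IsWindowFunction a u) (hv : IsWindowFunction a v) (t : ℝ) :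
    Integrable fun x ↦ u (x + t) * conj (v x) := by
  obtain ⟨S, hS0, hS⟩ := hu.bounded'
  obtain ⟨T, hT0, hT⟩ := hv.bounded'
  have hint : Integrable fun x ↦ (Icc (-a) a).indicator (fun _ ↦ S * T) x :=
    (integrable_indicator_iff measurableSet_Icc).2 (integrableOn_const (by simp [Real.volume_Icc]))
  refine hint.mono' (((hu.measurable.comp (measurable_id.add_const t)).mul
    (Complex.continuous_conj.measurable.comp hv.measurable)).aestronglyMeasurable)
    (Eventually.of_forall fun x ↦ ?_)
  by_cases hx : x ∈ Icc (-a) a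
  · rw [indicator_of_mem hx, norm_mul, Complex.norm_conj]
    exact mul_le_mul (hS _) (hT x) (norm_nonneg _) hS0
  · rw [hv.eq_zero x hx, indicator_of_notMem hx, map_zero, mul_zero, norm_zero]

/-- `u(x) · conj v(x + t)` is integrable for window functions `u, v`. -/
theorem integrable_mul_conj_shift (hu : IsWindowFunction a u) (hv : IsWindowFunction a v) (t : ℝ) :
    Integrable fun x ↦ u x * conj (v (x + t)) := by
  obtain ⟨S, hS0, hS⟩ := hu.bounded'
  obtain ⟨T, hT0, hT⟩ := hv.bounded'
  have hint : Integrable fun x ↦ (Icc (-a) a).indicator (fun _ ↦ S * T) x :=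
    (integrable_indicator_iff measurableSet_Icc).2 (integrableOn_const (by simp [Real.volume_Icc]))
  refine hint.mono' ((hu.measurable.mul (Complex.continuous_conj.measurable.comp
    (hv.measurable.comp (measurable_id.add_const t)))).aestronglyMeasurable)
    (Eventually.of_forall fun x ↦ ?_)
  by_cases hx : x ∈ Icc (-a) a
  · rw [indicator_of_mem hx, norm_mul, Complex.norm_conj]
    exact mul_le_mul (hS x) (hT _) (norm_nonneg _) hS0
  · rw [hu.eq_zero x hx, indicator_of_notMem hx, zero_mul, norm_zero]

end IsWindowFunction

/-- **The increment pairing through shifted overlaps.**  For window functions `u, v` and any `t`: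
`D_t(u, v) = ∫ (u(x+t) − u(x)) conj(v(x+t) − v(x)) dx = 2 ∫ u conj v − ∫ u(x+t) conj v(x) dx − conj ∫ v(x+t) conj u(x) dx`
(the two shifted factors together integrate to `∫ u conj v` by translation invariance). -/
theorem weilIncrementSesq_eq_overlap (hu : IsWindowFunction a u) (hv : IsWindowFunction a v) (t : ℝ) :
    weilIncrementSesq u v t =
      2 * (∫ x, u x * conj (v x)) - (∫ x, u (x + t) * conj (v x)) - conj (∫ x, v (x + t) * conj (u x)) := by
  have hpt : ∀ x, (u (x + t) - u x) * conj (v (x + t) - v x) =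
      u (x + t) * conj (v (x + t)) - u (x + t) * conj (v x) - u x * conj (v (x + t)) + u x * conj (v x) := by
    intro x; rw [map_sub]; ring
  unfold weilIncrementSesq
  simp_rw [hpt]
  have iA : Integrable fun x ↦ u (x + t) * conj (v (x + t)) := (hu.integrable_mul_conj hv).comp_add_right t
  have iB : Integrable fun x ↦ u (x + t) * conj (v x) := hu.integrable_shift_mul_conj hv t
  have iC : Integrable fun x ↦ u x * conj (v (x + t)) := hu.integrable_mul_conj_shift hv t
  have iD : Integrable fun x ↦ u x * conj (v x) := hu.integrable_mul_conj hv
  have iAB : Integrable fun x ↦ u (x + t) * conj (v (x + t)) - u (x + t) * conj (v x) := iA.sub iB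
  have iABC : Integrable fun x ↦
      u (x + t) * conj (v (x + t)) - u (x + t) * conj (v x) - u x * conj (v (x + t)) := iAB.sub iC
  have hC : ∫ x, u x * conj (v (x + t)) = conj (∫ x, v (x + t) * conj (u x)) := by
    rw [← integral_conj]
    refine integral_congr_ae (Eventually.of_forall fun x ↦ ?_)
    simp only [map_mul, Complex.conj_conj]
    ring
  rw [integral_add iABC iD, integral_sub iAB iC, integral_sub iA iB,
    integral_add_right_eq_self (fun x ↦ u x * conj (v x)) t, hC]
  ring

/-! ## Indicator windows `1_{[−a,a]}·f` -/

/-- The product of two indicator windows is the indicator of the product. -/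
theorem indicator_mul_conj_indicator (a : ℝ) (f g : ℝ → ℂ) :
    (fun x ↦ (Icc (-a) a).indicator f x * conj ((Icc (-a) a).indicator g x)) =
      (Icc (-a) a).indicator (fun x ↦ f x * conj (g x)) := by
  funext x
  by_cases hx : x ∈ Icc (-a) a
  · simp only [indicator_of_mem hx]
  · simp only [indicator_of_notMem hx, zero_mul]

/-- `∫ (1f) conj(1g) = ∫_{−a}^{a} f conj g` (`a ≥ 0`). -/
theorem integral_indicator_mul_conj_indicator (ha : 0 ≤ a) (f g : ℝ → ℂ) :
    ∫ x, (Icc (-a) a).indicator f x * conj ((Icc (-a) a).indicator g x) = ∫ x in (-a)..a, f x * conj (g x) := by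
  rw [indicator_mul_conj_indicator, integral_indicator measurableSet_Icc, integral_Icc_eq_integral_Ioc,
    ← intervalIntegral.integral_of_le (by linarith)]

/-- For `t ≥ 0`, `(1f)(x + t) conj((1g)(x))` is the truncation to `[−a, a − t]` of `f(x+t) conj g(x)`. -/
theorem indicator_shift_mul_conj_indicator {t : ℝ} (ht : 0 ≤ t) (f g : ℝ → ℂ) :
    (fun x ↦ (Icc (-a) a).indicator f (x + t) * conj ((Icc (-a) a).indicator g x)) =
      (Icc (-a) (a - t)).indicator (fun x ↦ f (x + t) * conj (g x)) := by
  funext x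
  by_cases hx : x ∈ Icc (-a) (a - t)
  · have h := (mem_Icc_and_add_mem_Icc_iff ht).2 hx
    rw [indicator_of_mem hx, indicator_of_mem h.2, indicator_of_mem h.1]
  · rw [indicator_of_notMem hx]
    by_cases h1 : x ∈ Icc (-a) a
    · have h2 : x + t ∉ Icc (-a) a := fun h2 ↦ hx ((mem_Icc_and_add_mem_Icc_iff ht).1 ⟨h1, h2⟩)
      rw [indicator_of_notMem h2, zero_mul]
    · rw [indicator_of_notMem h1, map_zero, mul_zero]

/-- **Shifted overlap of indicator windows on the window scale** (`0 ≤ t ≤ 2a`):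
`∫ (1f)(x+t) conj((1g)(x)) dx = ∫_{−a}^{a−t} f(x+t) conj g(x) dx`. -/
theorem integral_indicator_shift_mul_conj_indicator {t : ℝ} (ht0 : 0 ≤ t) (ht : t ≤ 2 * a) (f g : ℝ → ℂ) :
    ∫ x, (Icc (-a) a).indicator f (x + t) * conj ((Icc (-a) a).indicator g x) =
      ∫ x in (-a)..(a - t), f (x + t) * conj (g x) := by
  rw [indicator_shift_mul_conj_indicator ht0, integral_indicator measurableSet_Icc, integral_Icc_eq_integral_Ioc,
    ← intervalIntegral.integral_of_le (by linarith)]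

/-- **Shifted overlap beyond the window scale** (`t ≥ 2a`, `a ≥ 0`): `∫ (1f)(x+t) conj((1g)(x)) dx = 0`. -/
theorem integral_indicator_shift_mul_conj_indicator_of_le (ha : 0 ≤ a) {t : ℝ} (ht : 2 * a ≤ t) (f g : ℝ → ℂ) :
    ∫ x, (Icc (-a) a).indicator f (x + t) * conj ((Icc (-a) a).indicator g x) = 0 := by
  rw [indicator_shift_mul_conj_indicator (by linarith), integral_indicator measurableSet_Icc,
    integral_Icc_eq_integral_Ioc, Set.Ioc_eq_empty (by intro h; linarith), setIntegral_empty]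

/-- **The increment pairing of two indicator windows on the window scale** (`0 ≤ t ≤ 2a`):
`D_t(1f, 1g) = 2∫_{−a}^{a} f conj g − ∫_{−a}^{a−t} f(x+t) conj g(x) dx − conj ∫_{−a}^{a−t} g(x+t) conj f(x) dx`
(for indicator windows that are window functions, e.g. `f, g ∈ C¹`: `isWindowFunction_indicator_of_hasDerivAt`). -/
theorem weilIncrementSesq_indicator {f g : ℝ → ℂ} (hf : IsWindowFunction a ((Icc (-a) a).indicator f))
    (hg : IsWindowFunction a ((Icc (-a) a).indicator g)) {t : ℝ} (ht0 : 0 ≤ t) (ht : t ≤ 2 * a) :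
    weilIncrementSesq ((Icc (-a) a).indicator f) ((Icc (-a) a).indicator g) t =
      2 * (∫ x in (-a)..a, f x * conj (g x)) - (∫ x in (-a)..(a - t), f (x + t) * conj (g x)) -
        conj (∫ x in (-a)..(a - t), g (x + t) * conj (f x)) := by
  have ha : 0 ≤ a := by linarith
  rw [weilIncrementSesq_eq_overlap hf hg, integral_indicator_mul_conj_indicator ha,
    integral_indicator_shift_mul_conj_indicator ht0 ht, integral_indicator_shift_mul_conj_indicator ht0 ht]

/-- **The increment pairing of two indicator windows beyond the window scale** (`t ≥ 2a`, `a ≥ 0`):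
`D_t(1f, 1g) = 2∫_{−a}^{a} f conj g`. -/
theorem weilIncrementSesq_indicator_of_le (ha : 0 ≤ a) {f g : ℝ → ℂ}
    (hf : IsWindowFunction a ((Icc (-a) a).indicator f)) (hg : IsWindowFunction a ((Icc (-a) a).indicator g))
    {t : ℝ} (ht : 2 * a ≤ t) :
    weilIncrementSesq ((Icc (-a) a).indicator f) ((Icc (-a) a).indicator g) t =
      2 * ∫ x in (-a)..a, f x * conj (g x) := by
  rw [weilIncrementSesq_eq_overlap hf hg, integral_indicator_mul_conj_indicator ha,
    integral_indicator_shift_mul_conj_indicator_of_le ha ht, integral_indicator_shift_mul_conj_indicator_of_le ha ht,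
    map_zero, sub_zero, sub_zero]

/-! ## Monomial windows `x^j · 1_{[−a,a]}` -/

/-- The monomial window `x^j·1_{[−a,a]}` is a window function. -/
theorem isWindowFunction_indicator_pow (a : ℝ) (j : ℕ) :
    IsWindowFunction a ((Icc (-a) a).indicator fun x : ℝ ↦ ((x : ℂ)) ^ j) := by
  have h1 : ∀ x : ℝ, HasDerivAt (fun y : ℝ ↦ ((y : ℂ))) 1 x := fun x ↦ by
    simpa using (hasDerivAt_id (x : ℂ)).comp_ofReal
  refine isWindowFunction_indicator_of_hasDerivAt a (f₁ := fun x : ℝ ↦ (j : ℂ) * ((x : ℂ)) ^ (j - 1) * 1)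
    (fun x ↦ (h1 x).fun_pow j) ?_
  fun_prop

/-- The monomial is real: `(x : ℂ)^j = ((x^j : ℝ) : ℂ)`. -/
theorem ofReal_pow_eq (x : ℝ) (j : ℕ) : ((x : ℂ)) ^ j = ((x ^ j : ℝ) : ℂ) := by
  push_cast; rfl

/-- `∫_{−a}^{a} x^j conj(x^k) dx = (a^{j+k+1} − (−a)^{j+k+1})/(j+k+1)` (the `L²` inner product of two monomial windows). -/
theorem integral_pow_mul_conj_pow (a : ℝ) (j k : ℕ) :
    ∫ x in (-a)..a, ((x : ℂ)) ^ j * conj (((x : ℂ)) ^ k) =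
      (((a ^ (j + k + 1) - (-a) ^ (j + k + 1)) / (j + k + 1) : ℝ) : ℂ) := by
  have h : ∀ x : ℝ, ((x : ℂ)) ^ j * conj (((x : ℂ)) ^ k) = ((x ^ (j + k) : ℝ) : ℂ) := by
    intro x
    rw [map_pow, Complex.conj_ofReal]
    push_cast
    ring
  simp_rw [h]
  rw [intervalIntegral.integral_ofReal, integral_pow]
  push_cast
  ring

/-- `∫ (1x^j) conj(1x^k) = (a^{j+k+1} − (−a)^{j+k+1})/(j+k+1)` on `ℝ` (`a ≥ 0`). -/
theorem integral_indicator_pow_mul_conj_indicator_pow (ha : 0 ≤ a) (j k : ℕ) :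
    ∫ x, (Icc (-a) a).indicator (fun x : ℝ ↦ ((x : ℂ)) ^ j) x *
        conj ((Icc (-a) a).indicator (fun x : ℝ ↦ ((x : ℂ)) ^ k) x) =
      (((a ^ (j + k + 1) - (-a) ^ (j + k + 1)) / (j + k + 1) : ℝ) : ℂ) := by
  rw [integral_indicator_mul_conj_indicator ha, integral_pow_mul_conj_pow]

/-- **The shifted overlap of two monomials** (real form):
`∫_s^e (x+t)^j x^k dx = Σ_{i=0}^{j} C(j,i) t^{j−i} (e^{i+k+1} − s^{i+k+1})/(i+k+1)`. -/
theorem integral_add_pow_mul_pow (s e t : ℝ) (j k : ℕ) :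
    ∫ x in s..e, (x + t) ^ j * x ^ k =
      ∑ i ∈ Finset.range (j + 1), (j.choose i : ℝ) * t ^ (j - i) * ((e ^ (i + k + 1) - s ^ (i + k + 1)) / (i + k + 1)) := by
  have h : ∀ x : ℝ, (x + t) ^ j * x ^ k =
      ∑ i ∈ Finset.range (j + 1), (j.choose i : ℝ) * t ^ (j - i) * x ^ (i + k) := by
    intro x
    rw [add_pow, Finset.sum_mul]
    refine Finset.sum_congr rfl fun i _ ↦ ?_
    ring
  simp_rw [h]
  rw [intervalIntegral.integral_finsetSum]
  · refine Finset.sum_congr rfl fun i _ ↦ ?_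
    rw [intervalIntegral.integral_const_mul, integral_pow]
    push_cast
    ring
  · intro i _
    exact (by fun_prop : Continuous fun x : ℝ ↦ (j.choose i : ℝ) * t ^ (j - i) * x ^ (i + k)).intervalIntegrable _ _

/-- The shifted overlap of two monomial windows (complex form): `∫_s^e (x+t)^j conj(x^k) dx` as the cast of the real sum. -/
theorem integral_shift_pow_mul_conj_pow (s e t : ℝ) (j k : ℕ) :
    ∫ x in s..e, (((x + t : ℝ) : ℂ)) ^ j * conj (((x : ℂ)) ^ k) =
      ((∑ i ∈ Finset.range (j + 1), (j.choose i : ℝ) * t ^ (j - i) *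
        ((e ^ (i + k + 1) - s ^ (i + k + 1)) / (i + k + 1)) : ℝ) : ℂ) := by
  have h : ∀ x : ℝ, (((x + t : ℝ) : ℂ)) ^ j * conj (((x : ℂ)) ^ k) = (((x + t) ^ j * x ^ k : ℝ) : ℂ) := by
    intro x
    rw [map_pow, Complex.conj_ofReal]
    push_cast
    ring
  simp_rw [h]
  rw [intervalIntegral.integral_ofReal, integral_add_pow_mul_pow]

/-- **The increment pairing of two monomial windows on the window scale** (`0 ≤ t ≤ 2a`), a REAL polynomial in `t`:
`D_t(1x^j, 1x^k) = 2(a^{j+k+1} − (−a)^{j+k+1})/(j+k+1)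
   − Σ_{i≤j} C(j,i) t^{j−i}((a−t)^{i+k+1} − (−a)^{i+k+1})/(i+k+1) − Σ_{i≤k} C(k,i) t^{k−i}((a−t)^{i+j+1} − (−a)^{i+j+1})/(i+j+1)`. -/
theorem weilIncrementSesq_indicator_pow (j k : ℕ) {t : ℝ} (ht0 : 0 ≤ t) (ht : t ≤ 2 * a) :
    weilIncrementSesq ((Icc (-a) a).indicator fun x : ℝ ↦ ((x : ℂ)) ^ j)
        ((Icc (-a) a).indicator fun x : ℝ ↦ ((x : ℂ)) ^ k) t =
      ((2 * ((a ^ (j + k + 1) - (-a) ^ (j + k + 1)) / (j + k + 1))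
        - (∑ i ∈ Finset.range (j + 1), (j.choose i : ℝ) * t ^ (j - i) *
            (((a - t) ^ (i + k + 1) - (-a) ^ (i + k + 1)) / (i + k + 1)))
        - (∑ i ∈ Finset.range (k + 1), (k.choose i : ℝ) * t ^ (k - i) *
            (((a - t) ^ (i + j + 1) - (-a) ^ (i + j + 1)) / (i + j + 1))) : ℝ) : ℂ) := by
  rw [weilIncrementSesq_indicator (isWindowFunction_indicator_pow a j) (isWindowFunction_indicator_pow a k) ht0 ht,
    integral_pow_mul_conj_pow, integral_shift_pow_mul_conj_pow, integral_shift_pow_mul_conj_pow, Complex.conj_ofReal]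
  push_cast
  ring

/-- **The increment pairing of two monomial windows beyond the window scale** (`t ≥ 2a`, `a ≥ 0`):
`D_t(1x^j, 1x^k) = 2(a^{j+k+1} − (−a)^{j+k+1})/(j+k+1)`. -/
theorem weilIncrementSesq_indicator_pow_of_le (ha : 0 ≤ a) (j k : ℕ) {t : ℝ} (ht : 2 * a ≤ t) :
    weilIncrementSesq ((Icc (-a) a).indicator fun x : ℝ ↦ ((x : ℂ)) ^ j)
        ((Icc (-a) a).indicator fun x : ℝ ↦ ((x : ℂ)) ^ k) t =
      ((2 * ((a ^ (j + k + 1) - (-a) ^ (j + k + 1)) / (j + k + 1)) : ℝ) : ℂ) := by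
  rw [weilIncrementSesq_indicator_of_le ha (isWindowFunction_indicator_pow a j) (isWindowFunction_indicator_pow a k) ht,
    integral_pow_mul_conj_pow]
  push_cast
  ring

/-- **The prime block of two monomial windows.**  The prime lengths `log n < 2a` of `weilPrimeIndex a` lie on the window
scale, so `Σ_{log n<2a} Λ(n) n^{-1/2} D_{log n}(1x^j, 1x^k)` is the (cast of the) real sum of the window-scale polynomial of
`weilIncrementSesq_indicator_pow` evaluated at `t = log n`. -/
theorem sum_prime_weilIncrementSesq_indicator_pow (j k : ℕ) :
    ∑ n ∈ weilPrimeIndex a, ((Λ n : ℝ) / Real.sqrt n : ℂ) *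
        weilIncrementSesq ((Icc (-a) a).indicator fun x : ℝ ↦ ((x : ℂ)) ^ j)
          ((Icc (-a) a).indicator fun x : ℝ ↦ ((x : ℂ)) ^ k) (Real.log n) =
      ((∑ n ∈ weilPrimeIndex a, (Λ n : ℝ) / Real.sqrt n *
        (2 * ((a ^ (j + k + 1) - (-a) ^ (j + k + 1)) / (j + k + 1))
          - (∑ i ∈ Finset.range (j + 1), (j.choose i : ℝ) * Real.log n ^ (j - i) *
              (((a - Real.log n) ^ (i + k + 1) - (-a) ^ (i + k + 1)) / (i + k + 1)))
          - (∑ i ∈ Finset.range (k + 1), (k.choose i : ℝ) * Real.log n ^ (k - i) *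
              (((a - Real.log n) ^ (i + j + 1) - (-a) ^ (i + j + 1)) / (i + j + 1)))) : ℝ) : ℂ) := by
  push_cast
  refine Finset.sum_congr rfl fun n hn ↦ ?_
  have hlt : Real.log n < 2 * a := mem_weilPrimeIndex.1 hn
  rw [weilIncrementSesq_indicator_pow j k (Real.log_natCast_nonneg n) hlt.le]
  push_cast
  ring

end Summit.RiemannHypothesis.RiemannHypothesis.Theorems.WeilFormatC

end
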